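import Summits.ABC.StewartYu.PadicG3Slab
import Summits.ABC.StewartYu.FeldmanDirectionalWeights
import Summits.ABC.StewartYu.FeldmanZeroDirectionWeights
import HarnessLib

/-!
# Cell abc-stewartyu, crux `Y07Odd` (stmt-ABC-19658), line `gen3-slab-odd`: the VALUES of the Gen-3 auxiliary
# function at the integer points — unknowns, equations, the rational core `qTerm`, denominators and integrality

`Summits/ABC/StewartYu/PadicG3Values.lean` — cell `abc-stewartyu` (design HOME/p2/SETUP3-SPEC.md §B–§C; seat p2-g4,
F-odd lead).  Plain definitions and theorems; no named fact.  Sequel to `PadicG3Setup` / `PadicG3Slab`.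

At level `0` the unknowns are `p(ℓ₀, λ)`, `ℓ₀ ≤ L₀`, `λ ∈ 𝔏` (the slab class of Matveev's box, `PadicG3Slab`), and the
equation at the node `x ∈ ℤ`, `|x| ≤ X`, and the multi-index `m = (m₀; m′)` (`m′ j₀ = 0`, `m₀ + |m′| ≤ M`) is, in
Fel'dman's basis (Nesterenko 2003 (3.30)/(3.34) at `s = 0`, `w = 0`),
`Σ p(ℓ₀,λ) · zW(ℓ₀,m₀; 2^S x) · ∏_{k} Δ_{m_k}(𝔛 λ k) · ∏ⱼ αⱼ^{(λⱼ − λ⁰ⱼ)x} = 0`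
— an identity between RATIONAL numbers (the twist class is constant on `𝔏`, `G3Setup.prod_ω_zpow`).  This file
defines these rational cores and proves what Siegel's lemma over `ℤ` (`SiegelFinset.exists_int_vec_of_finset`)
needs: a positive integer `Dclear x` with `Dclear x · qTerm ∈ ℤ`.

* `unk L₀ 𝔏` (unknown index set), `midx M` (multi-indices with `m j₀ = 0`, `|m| ≤ M`), `eqs X M`;
* `zW`, `dW` (integer weights: `DirWeights.zeroWeight`, `∏ Ring.multichoose (𝔛 λ k) (m k)`), `qE` (the Laurent
  monomial value `∏ αⱼ^{(λⱼ−λ⁰ⱼ)x}`), `qTerm`, `coreSum`;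
* `clearZpow` — `(|num q|·den q)^{|e|} · q^e ∈ ℤ`; `Dclear`, `exists_int_Dclear_mul_qTerm`.

WHAT THIS IS NOT: sizes and the Siegel step itself (`PadicG3Siegel.lean`); no crux moves.

## References
* Yu. V. Nesterenko, LNM 1819 (2003), §3.5 (3.28)–(3.34), (3.43). [Nesterenko2003]
* K. Yu, Compositio Math. 74 (1990), §2.3 (the class-restricted Siegel step). [Yu1990]
-/

noncomputable section

open Finset
open Literature.NumberTheory.Transcendental

namespace Summit.ABC.StewartYu

namespace G3Setup

variable {p : ℕ} [Fact p.Prime] (S : G3Setup p)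

/-! ### Index sets -/

/-- The unknowns of level `0`: `(ℓ₀, λ)` with `ℓ₀ ≤ L₀` and `λ` in the slab class `𝔏`.
[cite: Nesterenko2003, §3.5 (3.22)] -/
def unk (L₀ : ℕ) (𝔏 : Finset (Fin S.n → ℤ)) : Finset (ℕ × (Fin S.n → ℤ)) := (range (L₀ + 1)) ×ˢ 𝔏

/-- `#unk = (L₀+1)·#𝔏`. [folklore] -/
theorem card_unk (L₀ : ℕ) (𝔏 : Finset (Fin S.n → ℤ)) : (S.unk L₀ 𝔏).card = (L₀ + 1) * 𝔏.card := by
  unfold unk; rw [card_product, card_range]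

/-- The derivative multi-indices: `m : Fin n → ℕ` with `m j₀ = 0` (no pivot direction) and total order `≤ M`,
together with the `Y₀`-order `m₀ ≤ M − |m|`; packaged as pairs `(m₀, m)`. [cite: Nesterenko2003, §3.5 (3.25)] -/
def midx (M : ℕ) : Finset (ℕ × (Fin S.n → ℕ)) :=
  ((range (M + 1)) ×ˢ Fintype.piFinset fun _ => range (M + 1)).filter
    fun m => m.2 S.j₀ = 0 ∧ m.1 + ∑ k, m.2 k ≤ M

/-- Membership in `midx`. [folklore] -/
theorem mem_midx {M : ℕ} {m : ℕ × (Fin S.n → ℕ)} :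
    m ∈ S.midx M ↔ m.2 S.j₀ = 0 ∧ m.1 + ∑ k, m.2 k ≤ M := by
  unfold midx
  rw [mem_filter, mem_product, mem_range, Fintype.mem_piFinset]
  constructor
  · exact fun h => h.2
  · intro h
    refine ⟨⟨by omega, fun k => mem_range.mpr ?_⟩, h⟩
    have : m.2 k ≤ ∑ k, m.2 k := single_le_sum (fun _ _ => Nat.zero_le _) (mem_univ k)
    omega

/-- The equations of level `0`: nodes `|x| ≤ X` times multi-indices. [cite: Nesterenko2003, §3.5 (3.25)] -/
def eqs (X M : ℕ) : Finset (ℤ × (ℕ × (Fin S.n → ℕ))) := (Icc (-(X : ℤ)) X) ×ˢ S.midx M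

/-! ### The weights and the rational cores -/

/-- The direction-`0` integer weight `zW = ν(H)^{m₀}·Δ^{(m₀)}(y; ℓ₀, H)/m₀!` at `y = 2^{S}·x`
(`DirWeights.zeroWeight`). [cite: Nesterenko2003, §3.5 (3.34)] -/
def zW (H Slev : ℕ) (ℓ₀ m₀ : ℕ) (x : ℤ) : ℤ := DirWeights.zeroWeight ℓ₀ H m₀ (2 ^ Slev * x)

/-- The directional integer weight `dW = ∏ₖ Δ_{mₖ}(𝔛 λ k) = ∏ₖ multichoose(𝔛 λ k, mₖ)` (the factor `k = j₀` is
`multichoose(0, 0) = 1` on `midx`). [cite: Nesterenko2003, §3.5 (3.34)] -/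
def dW (m : Fin S.n → ℕ) (lam : Fin S.n → ℤ) : ℤ := ∏ k, Ring.multichoose (S.𝔛 lam k) (m k)

/-- `dW` is the value of the product of the `dirDelta` polynomials (cast to a field of characteristic `0`).
[cite: Nesterenko2003, §3.5 (3.34)] -/
theorem cast_dW (K : Type*) [Field K] [CharZero K] (m : Fin S.n → ℕ) (lam : Fin S.n → ℤ) :
    ((S.dW m lam : ℤ) : K) = ∏ k, (DirWeights.dirDelta K (m k)).eval ((S.𝔛 lam k : ℤ) : K) := by
  unfold dW
  rw [DirWeights.prod_dirDelta_eval_intCast]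

/-- The Laurent monomial value `qE = ∏ⱼ αⱼ^{(λⱼ − λ⁰ⱼ)·x} ∈ ℚ`. [cite: Nesterenko2003, §3.5 (3.30) (the factor c)] -/
def qE (lam0 lam : Fin S.n → ℤ) (x : ℤ) : ℚ := ∏ j, S.α j ^ ((lam j - lam0 j) * x)

/-- `qE ≠ 0`. [folklore] -/
theorem qE_ne (lam0 lam : Fin S.n → ℤ) (x : ℤ) : S.qE lam0 lam x ≠ 0 :=
  prod_ne_zero_iff.mpr fun j _ => zpow_ne_zero _ (S.α_ne j)

/-- **The rational core of one term** of the equation `(x; m₀, m)`: `zW · dW · qE`.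
[cite: Nesterenko2003, §3.5 (3.30), (3.34)] -/
def qTerm (H Slev : ℕ) (lam0 : Fin S.n → ℤ) (u : ℕ × (Fin S.n → ℤ)) (x : ℤ) (m : ℕ × (Fin S.n → ℕ)) : ℚ :=
  ((zW H Slev u.1 m.1 x * S.dW m.2 u.2 : ℤ) : ℚ) * S.qE lam0 u.2 x

/-- **The rational core of the equation** `(x; m₀, m)`: `coreSum = Σ_u p(u) · qTerm(u)`.
[cite: Nesterenko2003, §3.5 (3.30)] -/
def coreSum (H Slev : ℕ) (lam0 : Fin S.n → ℤ) (U : Finset (ℕ × (Fin S.n → ℤ))) (pv : ℕ × (Fin S.n → ℤ) → ℤ)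
    (x : ℤ) (m : ℕ × (Fin S.n → ℕ)) : ℚ :=
  ∑ u ∈ U, (pv u : ℚ) * S.qTerm H Slev lam0 u x m

/-! ### Clearing denominators -/

/-- For a non-zero rational `q` and an integer `e`, `(num q · den q)^{|e|} · q^e` is an integer
(`= num^{2|e|}` or `den^{2|e|}` according to the sign of `e`). [folklore] -/
theorem clearZpow (q : ℚ) (hq : q ≠ 0) (e : ℤ) :
    ∃ z : ℤ, ((q.num * q.den : ℤ) : ℚ) ^ e.natAbs * q ^ e = z := by
  have hnum : (q.num : ℚ) ≠ 0 := by exact_mod_cast Rat.num_ne_zero.mpr hq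
  have hden : (q.den : ℚ) ≠ 0 := by exact_mod_cast q.den_ne_zero
  have hq' : q = (q.num : ℚ) / q.den := (Rat.num_div_den q).symm
  set k := e.natAbs with hk
  have hqk : q ^ k = (q.num : ℚ) ^ k / (q.den : ℚ) ^ k := by rw [← div_pow, Rat.num_div_den q]
  rcases Int.natAbs_eq e with he | he
  · refine ⟨q.num ^ k * q.num ^ k, ?_⟩
    rw [he, ← hk, zpow_natCast, hqk]
    push_cast
    rw [mul_pow]
    field_simp
  · refine ⟨(q.den : ℤ) ^ k * q.den ^ k, ?_⟩
    rw [he, ← hk, zpow_neg, zpow_natCast, hqk]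
    push_cast
    rw [mul_pow]
    field_simp

/-- The common denominator of the Laurent monomial values at the node `x` on the box of half-sides `s`:
`Dclear = ∏ⱼ |num αⱼ · den αⱼ|^{2 sⱼ |x|}`. [cite: Nesterenko2003, §3.5 (3.43) (the height of the factor c)] -/
def Dclear (s : Fin S.n → ℕ) (x : ℤ) : ℕ := ∏ j, ((S.α j).num * (S.α j).den).natAbs ^ (2 * (s j * x.natAbs))

/-- `0 < Dclear`. [folklore] -/
theorem Dclear_pos (s : Fin S.n → ℕ) (x : ℤ) : 0 < S.Dclear s x := by
  unfold Dclear
  refine prod_pos fun j _ => pow_pos (Int.natAbs_pos.mpr (mul_ne_zero ?_ ?_)) _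
  · exact Rat.num_ne_zero.mpr (S.α_ne j)
  · exact_mod_cast (S.α j).den_ne_zero

/-- `Dclear` without absolute values (the exponents are even). [folklore] -/
theorem cast_Dclear (s : Fin S.n → ℕ) (x : ℤ) :
    ((S.Dclear s x : ℕ) : ℚ) = ∏ j, (((S.α j).num * (S.α j).den : ℤ) : ℚ) ^ (2 * (s j * x.natAbs)) := by
  unfold Dclear
  rw [Nat.cast_prod]
  refine prod_congr rfl fun j _ => ?_
  rw [Nat.cast_pow, Nat.cast_natAbs, Int.cast_abs, pow_mul, sq_abs, ← pow_mul]

/-- **Integrality**: for `λ, λ⁰` in the box of half-sides `s`, `Dclear(x) · qE(λ⁰, λ, x) ∈ ℤ`.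
[cite: Nesterenko2003, §3.5 (p. 72: the coordinates are rational with controlled denominators)] -/
theorem exists_int_Dclear_mul_qE {s : Fin S.n → ℕ} {lam0 lam : Fin S.n → ℤ} (h0 : lam0 ∈ S.box s)
    (hl : lam ∈ S.box s) (x : ℤ) : ∃ z : ℤ, ((S.Dclear s x : ℕ) : ℚ) * S.qE lam0 lam x = z := by
  classical
  rw [S.cast_Dclear]
  unfold qE
  rw [← prod_mul_distrib]
  -- factor by factor: the exponent `(λⱼ − λ⁰ⱼ)x` has `|·| ≤ 2 sⱼ |x|`
  have hfac : ∀ j, ∃ z : ℤ, (((S.α j).num * (S.α j).den : ℤ) : ℚ) ^ (2 * (s j * x.natAbs)) *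
      S.α j ^ ((lam j - lam0 j) * x) = z := by
    intro j
    have hb0 := (S.mem_box.mp h0) j
    have hbl := (S.mem_box.mp hl) j
    have he : ((lam j - lam0 j) * x).natAbs ≤ 2 * (s j * x.natAbs) := by
      rw [Int.natAbs_mul]
      have h1 : (lam j - lam0 j).natAbs ≤ 2 * s j := by
        have : |lam j - lam0 j| ≤ (s j : ℤ) + s j := (abs_sub _ _).trans (add_le_add hbl hb0)
        rw [Int.abs_eq_natAbs] at this
        omega
      calc (lam j - lam0 j).natAbs * x.natAbs ≤ (2 * s j) * x.natAbs := Nat.mul_le_mul_right _ h1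
        _ = 2 * (s j * x.natAbs) := by ring
    obtain ⟨z, hz⟩ := clearZpow (S.α j) (S.α_ne j) ((lam j - lam0 j) * x)
    obtain ⟨d, hd⟩ := Nat.exists_eq_add_of_le he
    refine ⟨((S.α j).num * (S.α j).den) ^ d * z, ?_⟩
    rw [hd, pow_add]
    push_cast at hz ⊢
    rw [← hz]
    ring
  choose z hz using hfac
  refine ⟨∏ j, z j, ?_⟩
  rw [Int.cast_prod]
  exact prod_congr rfl fun j _ => hz j

/-- **Integrality of the cleared core**: `Dclear(x) · qTerm ∈ ℤ` for unknowns in the box.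
[cite: Nesterenko2003, §3.5 (p. 72)] -/
theorem exists_int_Dclear_mul_qTerm (H Slev : ℕ) {s : Fin S.n → ℕ} {lam0 : Fin S.n → ℤ} (h0 : lam0 ∈ S.box s)
    {u : ℕ × (Fin S.n → ℤ)} (hu : u.2 ∈ S.box s) (x : ℤ) (m : ℕ × (Fin S.n → ℕ)) :
    ∃ z : ℤ, ((S.Dclear s x : ℕ) : ℚ) * S.qTerm H Slev lam0 u x m = z := by
  obtain ⟨z, hz⟩ := S.exists_int_Dclear_mul_qE h0 hu x
  refine ⟨(zW H Slev u.1 m.1 x * S.dW m.2 u.2) * z, ?_⟩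
  unfold qTerm
  rw [mul_left_comm, hz]
  push_cast
  ring

end G3Setup

end Summit.ABC.StewartYu

end
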